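import Mathlib.Analysis.Complex.Polynomial.Basic
import Mathlib.FieldTheory.IsAlgClosed.AlgebraicClosure
import Literature.RingTheory.MvPolynomial.GeomComponentsGaloisAction
import HarnessLib

/-!
# LangWeilTransfer — crux `ShatteringExclusion` (stmt-ValiantsHypothesis-6372), line `birth`:
# stub `stub_componentDescent` (Galois descent of a unibranch component)

Route `ValiantsHypothesis/LangWeilTransfer`, crux `ShatteringExclusion` (SE), registered line
`Cruxes/ShatteringExclusion/Lines/birth.lean`. The line cuts SE into constant descent for the
permanent (`stub_lowDegreeConstants`, open-problem grade), unibranching (`stub_unibranching`,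
conjecture grade) and the present **theorem of commutative algebra**:

* `stub_componentDescent` — for an ideal `I ⊆ ℚ[Y_1..Y_m]`, an intermediate field
  `ℚ ⊆ K ⊆ ℂ` of finite degree `≤ B` and a point `y ∈ K^m` lying on exactly ONE irreducible
  component of `V_ℂ(I)` (a unique minimal prime of `I·ℂ[Y]` below `ker (ev_y)`), some minimal
  prime `𝔭` of `I` has `0 < #minprimes(𝔭·ℚ̄[Y]) ≤ B`.

Proof (the classical Galois descent, Stacks Project Tags 038H/04KY/04KZ): embed `ℚ̄ ↪ ℂ`; the
coordinates of `y` are algebraic, so `y = ι ∘ y'` with `y' ∈ ℚ̄^m`; irreducible components of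
`V(I)` over `ℚ̄` and over `ℂ` correspond (`Literature…existsUnique_minimalPrimes_map_le_ker_iff`,
tensor products of domains over an algebraically closed field are domains), so `y'` lies on a
unique component `W = V(Q)` of `V(I)_ℚ̄`; `𝔭 := Q ∩ ℚ[Y]` is a minimal prime of `I` (flat going
down), the components of `V(𝔭)_ℚ̄` form the `Gal(ℚ̄/ℚ)`-orbit of `W` (transitivity, Mathlib's
profinite invariant theory), and the stabiliser of `W` contains `Gal(ℚ̄/E)` for
`E = ℚ(y') ≅ ℚ(y) ⊆ K`, whence at most `#Hom(E, ℚ̄) = [E:ℚ] ≤ [K:ℚ] ≤ B` components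
(`Literature…exists_mem_minimalPrimes_ncard_map_le_finrank`).

Honest framing: this closes the one PROVABLE stub of the line; the load-bearing stubs
(`stub_lowDegreeConstants`, `stub_unibranching`) and the crux SE stay open, the route
`LangWeilTransfer` stays conditional, and VP ≠ VNP is NOT proved here.
-/

noncomputable section

open MvPolynomial

-- the summit and the problem share the name `ValiantsHypothesis` (D-0017 single-conjunct layout)
set_option linter.dupNamespace false

namespace Summit.ValiantsHypothesis.ValiantsHypothesis.Theorems.LangWeilTransfer.ShatteringExclusion

/-- An element of `ℂ` algebraic over `ℚ` lies in the image of any `ℚ`-embedding `ℚ̄ → ℂ`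
(its minimal polynomial splits in `ℚ̄`, and the roots in `ℂ` are the images of the roots in
`ℚ̄`). [folklore] -/
theorem mem_range_of_isIntegral (ι : AlgebraicClosure ℚ →ₐ[ℚ] ℂ) {x : ℂ} (hx : IsIntegral ℚ x) :
    x ∈ Set.range ι := by
  have hsplit : ((minpoly ℚ x).map (algebraMap ℚ (AlgebraicClosure ℚ))).Splits :=
    IsAlgClosed.splits _
  have hroot : x ∈ (minpoly ℚ x).rootSet ℂ :=
    Polynomial.mem_rootSet.2 ⟨minpoly.ne_zero hx, minpoly.aeval ℚ x⟩
  rw [← hsplit.image_rootSet ι] at hroot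
  obtain ⟨z, -, hz⟩ := hroot
  exact ⟨z, hz⟩

/-- **Stub `ComponentDescent` — Galois descent of a unibranch component** (registered obligation
`stub_componentDescent` of crux `ShatteringExclusion`, line `birth`; signature verbatim): for an
ideal `I ⊆ ℚ[Y_1..Y_m]`, an intermediate field `ℚ ⊆ K ⊆ ℂ` of finite degree `≤ B` and a point
`y ∈ K^m` such that a unique minimal prime of `I·ℂ[Y]` lies below `ker (ev_y)`, some minimal
prime `𝔭 ⊇ I` has `0 < #minprimes(𝔭·ℚ̄[Y]) ≤ B` (the `ℚ`-closure of the component through `y`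
has at most `[K:ℚ]` geometric components: one Galois orbit, stabiliser `⊇ Gal(ℚ̄/ℚ(y))`).
[cite: StacksProject, Tag 04KZ] -/
theorem stub_componentDescent :
    ∀ (m B : ℕ) (I : Ideal (MvPolynomial (Fin m) ℚ)) (y : Fin m → ℂ) (K : IntermediateField ℚ ℂ),
      FiniteDimensional ℚ K → Module.finrank ℚ K ≤ B → (∀ v, y v ∈ K) →
        (∃! 𝔓 : Ideal (MvPolynomial (Fin m) ℂ),
            𝔓 ∈ (I.map (MvPolynomial.map (algebraMap ℚ ℂ))).minimalPrimes ∧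
              𝔓 ≤ RingHom.ker (MvPolynomial.aeval (R := ℂ) y)) →
          ∃ 𝔭 ∈ I.minimalPrimes,
            0 < ((Ideal.map (MvPolynomial.map (algebraMap ℚ (AlgebraicClosure ℚ))) 𝔭).minimalPrimes).ncard ∧
              ((Ideal.map (MvPolynomial.map (algebraMap ℚ (AlgebraicClosure ℚ))) 𝔭).minimalPrimes).ncard ≤ B := by
  intro m B I y K hKfd hKB hyK huniq
  haveI := hKfd
  -- `ℚ̄/ℚ` is Galois for the ambient `ℚ`-algebra structure (`DivisionRing.toRatAlgebra`); Mathlib's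
  -- instance is stated for `AlgebraicClosure.instAlgebra` (definitionally, not reducibly, equal),
  -- cf. `Literature.NumberTheory.GaloisRepresentations.Rat.isGalois_algebraicClosure`.
  haveI : IsGalois ℚ (AlgebraicClosure ℚ) :=
    @IsAlgClosure.isGalois ℚ (AlgebraicClosure ℚ) _ _ (AlgebraicClosure.instAlgebra ℚ) inferInstance
      inferInstance
  -- embed `ℚ̄` into `ℂ` over `ℚ`, as an algebra structure
  let ι : AlgebraicClosure ℚ →ₐ[ℚ] ℂ := IsAlgClosed.lift
  letI : Algebra (AlgebraicClosure ℚ) ℂ := ι.toRingHom.toAlgebra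
  have hιalg : algebraMap (AlgebraicClosure ℚ) ℂ = (ι : AlgebraicClosure ℚ →+* ℂ) := rfl
  haveI : IsScalarTower ℚ (AlgebraicClosure ℚ) ℂ :=
    IsScalarTower.of_algebraMap_eq fun x => by rw [hιalg]; exact (ι.commutes x).symm
  -- the coordinates of `y` are algebraic, hence images of points of `ℚ̄`
  have hyint : ∀ v, IsIntegral ℚ (y v) := fun v =>
    (Algebra.IsIntegral.isIntegral (R := ℚ) (⟨y v, hyK v⟩ : K)).map K.val
  have hyrange : ∀ v, ∃ z : AlgebraicClosure ℚ, ι z = y v := fun v =>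
    mem_range_of_isIntegral ι (hyint v)
  choose y' hy' using hyrange
  have hy : (algebraMap (AlgebraicClosure ℚ) ℂ) ∘ y' = y := funext fun v => by
    rw [Function.comp_apply, hιalg]; exact hy' v
  -- `I ℂ[Y] = (I ℚ̄[Y]) ℂ[Y]`
  have hI : I.map (MvPolynomial.map (algebraMap ℚ ℂ)) =
      (I.map (MvPolynomial.map (algebraMap ℚ (AlgebraicClosure ℚ)))).map
        (MvPolynomial.map (algebraMap (AlgebraicClosure ℚ) ℂ)) := by
    rw [Ideal.map_map]
    congr 1
    refine RingHom.ext fun p => ?_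
    rw [RingHom.comp_apply, MvPolynomial.map_map, ← IsScalarTower.algebraMap_eq]
  -- transfer the unibranch hypothesis from `ℂ` to `ℚ̄`
  rw [hI, ← hy] at huniq
  have huniq' := (Literature.RingTheory.MvPolynomial.existsUnique_minimalPrimes_map_le_ker_iff
    (I.map (MvPolynomial.map (algebraMap ℚ (AlgebraicClosure ℚ)))) y').1 huniq
  -- the number field generated by `y'`, of degree `≤ [K:ℚ] ≤ B`
  let E : IntermediateField ℚ (AlgebraicClosure ℚ) := IntermediateField.adjoin ℚ (Set.range y')
  haveI : FiniteDimensional ℚ E :=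
    IntermediateField.finiteDimensional_adjoin fun x _ => Algebra.IsIntegral.isIntegral x
  have hyE : ∀ v, y' v ∈ E := fun v => IntermediateField.subset_adjoin ℚ _ ⟨v, rfl⟩
  have hEK : Module.finrank ℚ E ≤ B := by
    have h1 : Module.finrank ℚ E = Module.finrank ℚ (E.map ι) :=
      (IntermediateField.equivMap E ι).toLinearEquiv.finrank_eq
    have h2 : E.map ι ≤ K := by
      rw [IntermediateField.adjoin_map, IntermediateField.adjoin_le_iff]
      rintro _ ⟨_, ⟨v, rfl⟩, rfl⟩
      rw [hy' v]
      exact hyK v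
    rw [h1]
    exact (IntermediateField.finrank_le_of_le_right h2).trans hKB
  obtain ⟨𝔭, h𝔭, hpos, hle⟩ :=
    Literature.RingTheory.MvPolynomial.exists_mem_minimalPrimes_ncard_map_le_finrank
      I y' E hyE huniq'
  exact ⟨𝔭, h𝔭, hpos, hle.trans hEK⟩

end Summit.ValiantsHypothesis.ValiantsHypothesis.Theorems.LangWeilTransfer.ShatteringExclusion

end
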